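import Mathlib.Analysis.InnerProductSpace.Adjoint
import Mathlib.Analysis.InnerProductSpace.PiL2
import Mathlib.Analysis.Complex.Polynomial.Basic
import Mathlib.LinearAlgebra.Charpoly.ToMatrix
import Mathlib.LinearAlgebra.Eigenspace.Triangularizable
import Mathlib.LinearAlgebra.Matrix.Charpoly.Eigs
import HarnessLib

/-!
# Schur's inequality `Σ |λᵢ|² ≤ ‖A‖_F²`

Topic `Literature/Analysis/InnerProduct`; support file (all proved; no definitions; no named facts).

For a linear endomorphism `T` of a finite-dimensional complex inner product space, the sum of the
squared moduli of the roots of its characteristic polynomial (eigenvalues WITH algebraic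
multiplicity) is at most its Hilbert–Schmidt sum `Σᵢ ‖T bᵢ‖²` in any orthonormal basis `b`
(`sum_norm_sq_roots_charpoly_le`); for a complex square matrix `Y` this is **Schur's inequality**
`Σ_{y ∈ roots χ_Y} |y|² ≤ Σ_{j,l} |Y_{jl}|²` (`matrix_sum_norm_sq_roots_charpoly_le`), I. Schur (1909).

Proof (Schur's own induction, without building the unitary triangularization as data): pick a
unit eigenvector `v` of the adjoint `T†`; then `W = v^⊥` is `T`-invariant, the matrix of `T` in an
orthonormal basis adapted to `W ⊕ ℂv` is block upper triangular, so
`χ_T = χ_{T|W} · (X − ⟨v, Tv⟩)` (Mathlib `Matrix.charpoly_fromBlocks_zero₂₁`), while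
`Σᵢ ‖T bᵢ‖² = Σⱼ ‖T cⱼ‖² + ‖T v‖² ≥ HS(T|W) + |⟨v, Tv⟩|²`; conclude by induction on the dimension.
The independence of the Hilbert–Schmidt sum from the orthonormal basis is the double Parseval
identity `Σᵢ ‖T bᵢ‖² = Σₖ ‖T† dₖ‖²` (`sum_norm_sq_apply_eq_sum_norm_sq_adjoint_apply`).

Companions used together with Schur's inequality in log-determinant estimates
`log |det(1 + Y)| = Σ log|1 + y|` (all elementary):
* `matrix_det_one_add_eq_prod_roots_charpoly` — `det(1 + Y) = Π_{y ∈ roots χ_Y} (1 + y)`;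
* `matrix_exists_mulVec_eq_smul_of_isRoot_charpoly` — every root of `χ_Y` has an eigenvector;
* `matrix_sum_norm_sq_mul_le` — `‖X₁X₂‖_F² ≤ ‖X₁‖_F² ‖X₂‖_F²` written with entry sums;
* `matrix_norm_trace_mul_le` — `|tr(X₁X₂)| ≤ ‖X₁‖_F ‖X₂‖_F`.

## Mathlib search

Mathlib (this pin) has `Matrix.det_eq_prod_roots_charpoly`, `Matrix.trace_eq_sum_roots_charpoly`,
`Module.End.exists_eigenvalue`, `LinearMap.adjoint`, `OrthonormalBasis.sum_sq_norm_inner_right`,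
`Matrix.frobenius_norm_mul` (as an `rpow (1/2)` norm inequality), but no Schur triangularization /
Schur form and no inequality between `Σ|λᵢ|²` and the Frobenius norm
(`lean search 'schur_triang|IsUpperTriangular.*unitary|sum.*roots.*charpoly.*norm'`: nothing relevant).

## References

* I. Schur, *Über die charakteristischen Wurzeln einer linearen Substitution mit einer Anwendung
  auf die Theorie der Integralgleichungen*, Math. Ann. 66 (1909), 488–510 (Satz II).
* R. A. Horn, C. R. Johnson, *Matrix Analysis*, 2nd ed., Cambridge University Press (2013), §2.3
  (unitary triangularization) and the "defect from normality" `Σ|λᵢ|² ≤ ‖A‖_F²`. [HornJohnson2013]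

Everything here is folklore.
-/

noncomputable section

namespace Literature.Analysis.InnerProduct

open scoped InnerProductSpace ComplexConjugate Matrix
open Module Polynomial

universe u

section HilbertSchmidt

variable {E : Type*} [NormedAddCommGroup E] [InnerProductSpace ℂ E] [FiniteDimensional ℂ E]

/-- **Hilbert–Schmidt sums through the adjoint**: for orthonormal bases `b`, `d` of a
finite-dimensional complex inner product space and a linear map `T`,
`Σᵢ ‖T bᵢ‖² = Σₖ ‖T† dₖ‖²` (Parseval twice). [folklore] -/
theorem sum_norm_sq_apply_eq_sum_norm_sq_adjoint_apply {ι κ : Type*} [Fintype ι] [Fintype κ]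
    (T : E →ₗ[ℂ] E) (b : OrthonormalBasis ι ℂ E) (d : OrthonormalBasis κ ℂ E) :
    ∑ i, ‖T (b i)‖ ^ 2 = ∑ k, ‖LinearMap.adjoint T (d k)‖ ^ 2 := by
  have h1 : ∀ i, ‖T (b i)‖ ^ 2 = ∑ k, ‖⟪d k, T (b i)⟫_ℂ‖ ^ 2 := fun i =>
    (d.sum_sq_norm_inner_right _).symm
  have h2 : ∀ k, ‖LinearMap.adjoint T (d k)‖ ^ 2 =
      ∑ i, ‖⟪LinearMap.adjoint T (d k), b i⟫_ℂ‖ ^ 2 := fun k =>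
    (b.sum_sq_norm_inner_left _).symm
  simp_rw [h1, h2, LinearMap.adjoint_inner_left]
  exact Finset.sum_comm

/-- The Hilbert–Schmidt sum `Σᵢ ‖T bᵢ‖²` does not depend on the orthonormal basis `b`.
[folklore] -/
theorem sum_norm_sq_apply_eq_of_orthonormalBasis {ι κ : Type*} [Fintype ι] [Fintype κ]
    (T : E →ₗ[ℂ] E) (b : OrthonormalBasis ι ℂ E) (d : OrthonormalBasis κ ℂ E) :
    ∑ i, ‖T (b i)‖ ^ 2 = ∑ k, ‖T (d k)‖ ^ 2 :=
  (sum_norm_sq_apply_eq_sum_norm_sq_adjoint_apply T b d).trans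
    (sum_norm_sq_apply_eq_sum_norm_sq_adjoint_apply T d d).symm

end HilbertSchmidt

/-- **Schur's inequality** (endomorphism form): for a linear endomorphism `T` of a
finite-dimensional complex inner product space and any orthonormal basis `b`,
`Σ_{z ∈ roots χ_T} |z|² ≤ Σᵢ ‖T bᵢ‖²` (roots of the characteristic polynomial counted with
multiplicity).  Schur, Math. Ann. 66 (1909), Satz II. [folklore] -/
theorem sum_norm_sq_roots_charpoly_le {E : Type u} [NormedAddCommGroup E]
    [InnerProductSpace ℂ E] [FiniteDimensional ℂ E] {ι : Type*} [Fintype ι] (T : E →ₗ[ℂ] E)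
    (b : OrthonormalBasis ι ℂ E) :
    ((T.charpoly.roots).map (fun z => ‖z‖ ^ 2)).sum ≤ ∑ i, ‖T (b i)‖ ^ 2 := by
  suffices h : ∀ (m : ℕ) (F : Type u) [NormedAddCommGroup F] [InnerProductSpace ℂ F]
      [FiniteDimensional ℂ F] (S : F →ₗ[ℂ] F), finrank ℂ F = m →
      ((S.charpoly.roots).map (fun z => ‖z‖ ^ 2)).sum ≤
        ∑ i, ‖S (stdOrthonormalBasis ℂ F i)‖ ^ 2 by
    rw [sum_norm_sq_apply_eq_of_orthonormalBasis T b (stdOrthonormalBasis ℂ E)]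
    exact h _ E T rfl
  intro m
  induction m with
  | zero =>
    intro F _ _ _ S hF
    have h1 : S.charpoly = 1 := by
      rw [← S.charpoly_monic.natDegree_eq_zero, S.charpoly_natDegree, hF]
    simp only [h1, Polynomial.roots_one, Multiset.empty_eq_zero, Multiset.map_zero,
      Multiset.sum_zero]
    positivity
  | succ m ih =>
    intro F _ _ _ S hF
    haveI : Nontrivial F := Module.nontrivial_of_finrank_eq_succ hF
    -- a unit eigenvector `v` of the adjoint
    obtain ⟨θ, hθ⟩ := Module.End.exists_eigenvalue (LinearMap.adjoint S)
    obtain ⟨v₀, hv₀⟩ := hθ.exists_hasEigenvector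
    have hv₀ne : v₀ ≠ 0 := hv₀.2
    have hv₀eq : LinearMap.adjoint S v₀ = θ • v₀ := hv₀.apply_eq_smul
    set v : F := ((‖v₀‖⁻¹ : ℝ) : ℂ) • v₀ with hv_def
    have hv1 : ‖v‖ = 1 := by
      rw [hv_def, norm_smul, Complex.norm_real, norm_inv, norm_norm,
        inv_mul_cancel₀ (norm_ne_zero_iff.mpr hv₀ne)]
    have hSv : LinearMap.adjoint S v = θ • v := by
      rw [hv_def, map_smul, hv₀eq, smul_comm]
    have hvne : v ≠ 0 := by
      rw [← norm_ne_zero_iff, hv1]; exact one_ne_zero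
    -- the invariant hyperplane `W = v^⊥`
    set W : Submodule ℂ F := (ℂ ∙ v)ᗮ with hW_def
    have hWmem : ∀ w, w ∈ W ↔ ⟪v, w⟫_ℂ = 0 := fun w =>
      Submodule.mem_orthogonal_singleton_iff_inner_right
    have hWinv : ∀ w ∈ W, S w ∈ W := by
      intro w hw
      rw [hWmem] at hw ⊢
      rw [← LinearMap.adjoint_inner_left, hSv, inner_smul_left, hw, mul_zero]
    have hWdim : finrank ℂ W = m := by
      have h1 := Submodule.finrank_add_finrank_orthogonal (ℂ ∙ v)
      rw [finrank_span_singleton hvne, hF, ← hW_def] at h1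
      omega
    set SW : W →ₗ[ℂ] W := S.restrict hWinv with hSW_def
    set c : OrthonormalBasis (Fin (finrank ℂ W)) ℂ W := stdOrthonormalBasis ℂ W with hc_def
    have IH := ih W SW hWdim
    -- the adapted orthonormal basis `(c, v)` of `F`
    set f : Fin (finrank ℂ W) ⊕ Unit → F := Sum.elim (fun j => (c j : F)) (fun _ => v)
      with hf_def
    have hf_on : Orthonormal ℂ f := by
      classical
      rw [orthonormal_iff_ite]
      rintro (j | u) (k | u')
      · simp only [hf_def, Sum.elim_inl, Sum.inl.injEq]
        rw [← Submodule.coe_inner, c.inner_eq_ite]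
      · simp only [hf_def, Sum.elim_inl, Sum.elim_inr, reduceCtorEq, if_false]
        rw [← inner_conj_symm, (hWmem _).mp (c j).2, map_zero]
      · simp only [hf_def, Sum.elim_inl, Sum.elim_inr, reduceCtorEq, if_false]
        exact (hWmem _).mp (c k).2
      · have huu : Sum.inr (α := Fin (finrank ℂ W)) u = Sum.inr u' :=
          congrArg Sum.inr (Subsingleton.elim u u')
        simp only [hf_def, Sum.elim_inr, huu, if_true]
        rw [inner_self_eq_norm_sq_to_K, hv1]
        simp
    have hcard : Fintype.card (Fin (finrank ℂ W) ⊕ Unit) = finrank ℂ F := by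
      simp [hWdim, hF]
    set b' : OrthonormalBasis (Fin (finrank ℂ W) ⊕ Unit) ℂ F :=
      OrthonormalBasis.mk hf_on
        (hf_on.linearIndependent.span_eq_top_of_card_eq_finrank' hcard).ge with hb'_def
    have hb' : ∀ i, b' i = f i := fun i => by rw [hb'_def, OrthonormalBasis.coe_mk]
    -- the block upper triangular matrix of `S` in the adapted basis
    set μ : ℂ := ⟪v, S v⟫_ℂ with hμ_def
    classical
    set A : Matrix (Fin (finrank ℂ W)) (Fin (finrank ℂ W)) ℂ :=
      LinearMap.toMatrix c.toBasis c.toBasis SW with hA_def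
    set B : Matrix (Fin (finrank ℂ W)) Unit ℂ := Matrix.of fun j _ => ⟪(c j : F), S v⟫_ℂ
      with hB_def
    set D : Matrix Unit Unit ℂ := Matrix.of fun _ _ => μ with hD_def
    have hM : LinearMap.toMatrix b'.toBasis b'.toBasis S = Matrix.fromBlocks A B 0 D := by
      ext i k
      rw [LinearMap.toMatrix_apply, b'.coe_toBasis_repr_apply, b'.repr_apply_apply,
        b'.coe_toBasis, hb', hb']
      rcases i with j | u <;> rcases k with k | u'
      · rw [Matrix.fromBlocks_apply₁₁, hA_def, LinearMap.toMatrix_apply,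
          c.coe_toBasis_repr_apply, c.repr_apply_apply, c.coe_toBasis, Submodule.coe_inner,
          hSW_def, LinearMap.coe_restrict_apply]
        simp [hf_def]
      · simp [Matrix.fromBlocks_apply₁₂, hf_def, hB_def]
      · rw [Matrix.fromBlocks_apply₂₁, Matrix.zero_apply]
        simpa [hf_def] using (hWmem _).mp (hWinv _ (c k).2)
      · simp [Matrix.fromBlocks_apply₂₂, hf_def, hD_def, hμ_def]
    have hDchar : D.charpoly = X - C μ := by
      rw [Matrix.charpoly, Matrix.det_unique, Matrix.charmatrix_apply_eq]
      simp [hD_def]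
    have hchar : S.charpoly = SW.charpoly * (X - C μ) := by
      rw [← LinearMap.charpoly_toMatrix S b'.toBasis, hM, Matrix.charpoly_fromBlocks_zero₂₁,
        LinearMap.charpoly_toMatrix, hDchar]
    have hroots : S.charpoly.roots = SW.charpoly.roots + {μ} := by
      rw [hchar, Polynomial.roots_mul ((SW.charpoly_monic).mul (monic_X_sub_C μ)).ne_zero,
        Polynomial.roots_X_sub_C]
    rw [hroots, Multiset.map_add, Multiset.sum_add, Multiset.map_singleton,
      Multiset.sum_singleton]
    -- the Hilbert–Schmidt side in the adapted basis
    rw [sum_norm_sq_apply_eq_of_orthonormalBasis S (stdOrthonormalBasis ℂ F) b',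
      Fintype.sum_sum_type]
    simp only [Finset.univ_unique, Finset.sum_singleton, hb', hf_def, Sum.elim_inl,
      Sum.elim_inr]
    have hIH' : ((SW.charpoly.roots).map (fun z => ‖z‖ ^ 2)).sum ≤ ∑ j, ‖S (c j)‖ ^ 2 := by
      refine IH.trans (le_of_eq (Finset.sum_congr rfl fun j _ => ?_))
      rw [hSW_def, Submodule.coe_norm, LinearMap.coe_restrict_apply]
    have hμle : ‖μ‖ ^ 2 ≤ ‖S v‖ ^ 2 := by
      have h := norm_inner_le_norm (𝕜 := ℂ) v (S v)
      rw [hv1, one_mul] at h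
      rw [hμ_def]
      exact pow_le_pow_left₀ (norm_nonneg _) h 2
    exact add_le_add hIH' hμle

section MatrixForm

variable {n p q : Type*} [Fintype n] [Fintype p] [Fintype q]

/-- **Schur's inequality** for complex square matrices: the sum of the squared moduli of the
roots of the characteristic polynomial (eigenvalues with algebraic multiplicity) is at most the
squared Frobenius norm, `Σ_{y ∈ roots χ_Y} |y|² ≤ Σ_{i,j} |Y_{ij}|²`.  Schur (1909), Satz II;
Horn–Johnson (2013), §2.3. [folklore] -/
theorem matrix_sum_norm_sq_roots_charpoly_le [DecidableEq n] (Y : Matrix n n ℂ) :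
    ((Y.charpoly.roots).map (fun z => ‖z‖ ^ 2)).sum ≤ ∑ i, ∑ j, ‖Y i j‖ ^ 2 := by
  have hT : (Matrix.toEuclideanLin Y).charpoly = Y.charpoly := by
    rw [Matrix.toEuclideanLin_eq_toLin_orthonormal, Matrix.charpoly_toLin]
  have h := sum_norm_sq_roots_charpoly_le (Matrix.toEuclideanLin Y) (EuclideanSpace.basisFun n ℂ)
  rw [hT] at h
  refine h.trans (le_of_eq ?_)
  rw [Finset.sum_comm]
  refine Finset.sum_congr rfl fun l _ => ?_
  rw [EuclideanSpace.norm_sq_eq]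
  refine Finset.sum_congr rfl fun j _ => ?_
  simp [Matrix.toLpLin_apply]

/-- `det (1 + Y) = Π_{y ∈ roots χ_Y} (1 + y)` for a complex square matrix (the characteristic
polynomial splits; evaluate it at `−1`). [folklore] -/
theorem matrix_det_one_add_eq_prod_roots_charpoly [DecidableEq n] (Y : Matrix n n ℂ) :
    (1 + Y).det = ((Y.charpoly.roots).map (fun y => 1 + y)).prod := by
  have hsplit : Y.charpoly.Splits := IsAlgClosed.splits _
  have hcard : Multiset.card Y.charpoly.roots = Fintype.card n := by
    rw [← hsplit.natDegree_eq_card_roots, Matrix.charpoly_natDegree_eq_dim]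
  have h1 : Y.charpoly.eval (-1) = (Matrix.scalar n (-1 : ℂ) - Y).det :=
    Matrix.eval_charpoly Y (-1)
  have h2 : Matrix.scalar n (-1 : ℂ) - Y = -(1 + Y) := by
    rw [map_neg, map_one, neg_add, sub_eq_add_neg]
  rw [h2, Matrix.det_neg, hsplit.eval_eq_prod_roots_of_monic Y.charpoly_monic] at h1
  have h3 : (Y.charpoly.roots.map (fun a => -1 - a)).prod =
      (-1) ^ Fintype.card n * (Y.charpoly.roots.map (fun y => 1 + y)).prod := by
    have h4 : (fun a : ℂ => -1 - a) = (fun a => (-1) * (1 + a)) := by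
      funext a; ring
    rw [h4, Multiset.prod_map_mul, Multiset.map_const', Multiset.prod_replicate, hcard]
  rw [h3] at h1
  have hu : ((-1 : ℂ) ^ Fintype.card n) ≠ 0 := pow_ne_zero _ (neg_ne_zero.mpr one_ne_zero)
  exact (mul_left_cancel₀ hu h1).symm

/-- Every root of the characteristic polynomial of a square matrix over a field is an
eigenvalue: it has a non-zero eigenvector. [folklore] -/
theorem matrix_exists_mulVec_eq_smul_of_isRoot_charpoly {K : Type*} [Field K] [DecidableEq n]
    (Y : Matrix n n K) {y : K} (hy : Y.charpoly.IsRoot y) :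
    ∃ u : n → K, u ≠ 0 ∧ Y *ᵥ u = y • u := by
  have hdet : (Matrix.scalar n y - Y).det = 0 := by
    rw [← Matrix.eval_charpoly]; exact hy
  obtain ⟨u, hu, hu0⟩ := Matrix.exists_mulVec_eq_zero_iff.mpr hdet
  refine ⟨u, hu, ?_⟩
  have hsc : Matrix.scalar n y = y • (1 : Matrix n n K) := by
    rw [Matrix.scalar_apply, ← Matrix.smul_one_eq_diagonal]
  rw [Matrix.sub_mulVec, sub_eq_zero, hsc, Matrix.smul_mulVec, Matrix.one_mulVec] at hu0
  exact hu0.symm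

/-- **Frobenius submultiplicativity** with entry sums:
`Σ_{i,j} |(X₁X₂)_{ij}|² ≤ (Σ |X₁|²)(Σ |X₂|²)` (Cauchy–Schwarz in each entry). [folklore] -/
theorem matrix_sum_norm_sq_mul_le (X₁ : Matrix n p ℂ) (X₂ : Matrix p q ℂ) :
    ∑ i, ∑ j, ‖(X₁ * X₂) i j‖ ^ 2 ≤ (∑ i, ∑ l, ‖X₁ i l‖ ^ 2) * (∑ l, ∑ j, ‖X₂ l j‖ ^ 2) := by
  have hentry : ∀ i j, ‖(X₁ * X₂) i j‖ ^ 2 ≤ (∑ l, ‖X₁ i l‖ ^ 2) * (∑ l, ‖X₂ l j‖ ^ 2) := by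
    intro i j
    rw [Matrix.mul_apply]
    have h1 : ‖∑ l, X₁ i l * X₂ l j‖ ≤ ∑ l, ‖X₁ i l‖ * ‖X₂ l j‖ :=
      (norm_sum_le _ _).trans (le_of_eq (Finset.sum_congr rfl fun l _ => norm_mul _ _))
    calc ‖∑ l, X₁ i l * X₂ l j‖ ^ 2 ≤ (∑ l, ‖X₁ i l‖ * ‖X₂ l j‖) ^ 2 :=
          pow_le_pow_left₀ (norm_nonneg _) h1 2
      _ ≤ (∑ l, ‖X₁ i l‖ ^ 2) * (∑ l, ‖X₂ l j‖ ^ 2) := Finset.sum_mul_sq_le_sq_mul_sq _ _ _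
  calc ∑ i, ∑ j, ‖(X₁ * X₂) i j‖ ^ 2
        ≤ ∑ i, ∑ j, (∑ l, ‖X₁ i l‖ ^ 2) * (∑ l, ‖X₂ l j‖ ^ 2) := by
        gcongr with i _ j _
        exact hentry i j
    _ = (∑ i, ∑ l, ‖X₁ i l‖ ^ 2) * (∑ l, ∑ j, ‖X₂ l j‖ ^ 2) := by
        rw [Finset.sum_mul]
        refine Finset.sum_congr rfl fun i _ => ?_
        rw [← Finset.mul_sum, Finset.sum_comm]

/-- **Trace Cauchy–Schwarz**: `|tr (X₁ X₂)| ≤ √((Σ |X₁|²)(Σ |X₂|²)) = ‖X₁‖_F ‖X₂‖_F`.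
[folklore] -/
theorem matrix_norm_trace_mul_le (X₁ : Matrix n p ℂ) (X₂ : Matrix p n ℂ) :
    ‖(X₁ * X₂).trace‖ ≤ Real.sqrt ((∑ i, ∑ l, ‖X₁ i l‖ ^ 2) * (∑ l, ∑ i, ‖X₂ l i‖ ^ 2)) := by
  have htr : (X₁ * X₂).trace = ∑ i, ∑ l, X₁ i l * X₂ l i := by
    simp [Matrix.trace, Matrix.mul_apply]
  rw [htr]
  calc ‖∑ i, ∑ l, X₁ i l * X₂ l i‖
        ≤ ∑ i, ∑ l, ‖X₁ i l‖ * ‖X₂ l i‖ :=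
        norm_sum_le_of_le _ fun i _ =>
          (norm_sum_le _ _).trans (le_of_eq (Finset.sum_congr rfl fun l _ => norm_mul _ _))
    _ = ∑ x : n × p, ‖X₁ x.1 x.2‖ * ‖X₂ x.2 x.1‖ := (Fintype.sum_prod_type' _).symm
    _ ≤ √(∑ x : n × p, ‖X₁ x.1 x.2‖ ^ 2) * √(∑ x : n × p, ‖X₂ x.2 x.1‖ ^ 2) :=
        Real.sum_mul_le_sqrt_mul_sqrt _ _ _
    _ = √((∑ i, ∑ l, ‖X₁ i l‖ ^ 2) * (∑ l, ∑ i, ‖X₂ l i‖ ^ 2)) := by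
        rw [← Real.sqrt_mul (by positivity), Fintype.sum_prod_type, Fintype.sum_prod_type]
        congr 2
        exact Finset.sum_comm

end MatrixForm

end Literature.Analysis.InnerProduct
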